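import Literature.Probability.Divergences.RenyiDivergence
import Literature.Probability.Divergences.FDivVariational
import Literature.Probability.Divergences.KLDivConvexity
import Literature.Probability.Divergences.DonskerVaradhan
import Mathlib.MeasureTheory.Integral.MeanInequalities
import HarnessLib

/-!
# Crux `RestartPrinciple` (stmt-AtomisticToContinuum-12503), line `isentropic-regibbsification` — stub `stub_entropyRelay`

ENTROPY RELAY INEQUALITY (pure information theory). For probability measures `A, C, G` on one
measurable space and `γ > 0`:

  `KL(A ‖ G) ≤ (1 + γ⁻¹) · KL(A ‖ C) + D_{1+γ}(C ‖ G)`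

in `ℝ≥0∞` over Mathlib's `InformationTheory.klDiv` and the tree's
`Literature.Probability.Divergences.renyiDiv` / `hellingerIntegral` (RenyiDivergence.lean).

Proof: if `klDiv A C = ⊤` or `renyiDiv (1+γ) C G = ⊤` the right side is `⊤`. Otherwise the
Hellinger integral `H = ∫ (dC/dG)^{1+γ} dG` is finite, which for the order `1 + γ > 1` forces
`C ≪ G`, and `D_{1+γ}(C‖G) = γ⁻¹ log H` (clipped at `0`). By the Donsker–Varadhan upper bound for
bounded test functions (`klDiv_le_of_forall_integral_le`) it suffices to show, for every bounded
measurable `ψ`,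
`∫ ψ dA ≤ (1 + γ⁻¹) KL(A‖C) + γ⁻¹ log H + log ∫ e^ψ dG`.
This follows from the Gibbs inequality in log form for `A, C` and the test function
`(1 + γ⁻¹)⁻¹ ψ` (`integral_le_toReal_klDiv_add_log`) combined with Hölder's inequality with the
conjugate exponents `1 + γ⁻¹`, `1 + γ`:
`∫ e^{ψ/(1+γ⁻¹)} dC = ∫ e^{ψ/(1+γ⁻¹)} (dC/dG) dG ≤ (∫ e^ψ dG)^{1/(1+γ⁻¹)} · H^{1/(1+γ)}`.
[VanervenHarremoes2014; KipnisLandim1999 App. 1 §8]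
-/

noncomputable section

open MeasureTheory Filter Set Topology InformationTheory
open Literature.Probability.Divergences
open scoped ENNReal

namespace Summit.AtomisticToContinuum.HydrodynamicLimit.Theorems.RestartPrinciple.IsentropicRegibbsification

/-- **Entropy relay inequality** (registered stub `stub_entropyRelay` of line
`isentropic-regibbsification`, crux stmt-AtomisticToContinuum-12503): for probability measures
`A, C, G` and `γ > 0`, `KL(A ‖ G) ≤ (1 + γ⁻¹) · KL(A ‖ C) + D_{1+γ}(C ‖ G)`.
[cite: VanervenHarremoes2014, Def. 2; KipnisLandim1999, App. 1 Thm. 8.3] -/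
theorem stub_entropyRelay {Ω : Type*} [MeasurableSpace Ω] (A C G : Measure Ω)
    [IsProbabilityMeasure A] [IsProbabilityMeasure C] [IsProbabilityMeasure G] (γ : ℝ) (hγ : 0 < γ) :
    klDiv A G ≤ ENNReal.ofReal (1 + γ⁻¹) * klDiv A C + renyiDiv (1 + γ) C G := by
  have hγ0 : γ ≠ 0 := hγ.ne'
  have hγinv : 0 < γ⁻¹ := inv_pos.mpr hγ
  have hp' : (0 : ℝ) < 1 + γ⁻¹ := by positivity
  have hp : (0 : ℝ) < 1 + γ := by positivity
  have hp'0 : (1 + γ⁻¹ : ℝ) ≠ 0 := hp'.ne'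
  have hp0 : (1 + γ : ℝ) ≠ 0 := hp.ne'
  -- trivial cases: the right-hand side is `⊤`
  by_cases hKL : klDiv A C = ∞
  · have h0 : ENNReal.ofReal (1 + γ⁻¹) ≠ 0 := by
      rwa [ne_eq, ENNReal.ofReal_eq_zero, not_le]
    rw [hKL, ENNReal.mul_top h0, top_add]
    exact le_top
  by_cases hR : renyiDiv (1 + γ) C G = ∞
  · rw [hR, add_top]
    exact le_top
  -- finiteness of the Rényi divergence: `C ≪ G` and the Hellinger integral is finite
  set H : ℝ≥0∞ := hellingerIntegral (1 + γ) C G with hH_def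
  have hne1 : (1 + γ : ℝ) ≠ 1 := by
    intro h
    exact hγ0 (by linarith)
  have hγ1 : (1 + γ : ℝ) - 1 = γ := by ring
  have hRenyi : renyiDiv (1 + γ) C G = (((γ⁻¹ : ℝ) : EReal) * ENNReal.log H).toENNReal := by
    rw [renyiDiv_of_ne_one hne1, hγ1]
  have hHtop : H ≠ ∞ := by
    intro hH
    apply hR
    rw [hRenyi, hH, ENNReal.log_top, EReal.coe_mul_top_of_pos hγinv, EReal.toENNReal_top]
  have hCG : C ≪ G := by
    have h1 : hellingerIntegral (1 + γ) C G ≠ ∞ := hHtop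
    rw [hellingerIntegral, if_pos (by linarith : (1 : ℝ) < 1 + γ), ENNReal.add_ne_top] at h1
    have h2 : C.singularPart G univ = 0 := by
      by_contra h0
      exact h1.2 (ENNReal.top_mul h0)
    rwa [Measure.measure_univ_eq_zero, Measure.singularPart_eq_zero] at h2
  have hHint : H = ∫⁻ x, (C.rnDeriv G x) ^ (1 + γ) ∂G := hellingerIntegral_of_ac hCG
  -- the Rényi term dominates `γ⁻¹ log H`
  set L : ℝ := Real.log H.toReal with hL_def
  have hRge : ENNReal.ofReal (γ⁻¹ * L) ≤ renyiDiv (1 + γ) C G := by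
    by_cases hH0 : H = 0
    · simp [hL_def, hH0]
    · rw [hRenyi, ENNReal.log_pos_real hH0 hHtop, ← EReal.coe_mul, EReal.real_coe_toENNReal]
  -- reduce to a real bound tested on bounded measurable functions
  set K₁ : ℝ := (klDiv A C).toReal with hK₁_def
  have hKLeq : klDiv A C = ENNReal.ofReal K₁ := (ENNReal.ofReal_toReal hKL).symm
  suffices hmain : klDiv A G ≤ ENNReal.ofReal ((1 + γ⁻¹) * K₁ + γ⁻¹ * L) by
    calc klDiv A G ≤ ENNReal.ofReal ((1 + γ⁻¹) * K₁ + γ⁻¹ * L) := hmain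
      _ ≤ ENNReal.ofReal ((1 + γ⁻¹) * K₁) + ENNReal.ofReal (γ⁻¹ * L) := ENNReal.ofReal_add_le
      _ ≤ ENNReal.ofReal (1 + γ⁻¹) * klDiv A C + renyiDiv (1 + γ) C G := by
        rw [ENNReal.ofReal_mul hp'.le, ← hKLeq]
        exact add_le_add le_rfl hRge
  refine klDiv_le_of_forall_integral_le fun ψ Cψ hψm hψb => ?_
  -- Gibbs / Donsker–Varadhan (log form) for `A, C` and the test function `a • ψ`, `a = (1+γ⁻¹)⁻¹`
  set a : ℝ := (1 + γ⁻¹)⁻¹ with ha_def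
  have ha0 : 0 < a := inv_pos.mpr hp'
  have hφb : ∀ x, |a * ψ x| ≤ a * Cψ := fun x => by
    rw [abs_mul, abs_of_pos ha0]
    exact mul_le_mul_of_nonneg_left (hψb x) ha0.le
  have hDV := integral_le_toReal_klDiv_add_log hKL (hψm.const_mul a) hφb
  rw [integral_const_mul] at hDV
  -- the two partition functions
  have hexpψ : Integrable (fun x => Real.exp (ψ x)) G :=
    Integrable.of_bound hψm.exp.aestronglyMeasurable (Real.exp Cψ) (ae_of_all _ fun x => by
      rw [Real.norm_eq_abs, abs_of_pos (Real.exp_pos _)]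
      exact Real.exp_le_exp.2 ((le_abs_self _).trans (hψb x)))
  have hexpφ : Integrable (fun x => Real.exp (a * ψ x)) C :=
    Integrable.of_bound (hψm.const_mul a).exp.aestronglyMeasurable (Real.exp (a * Cψ))
      (ae_of_all _ fun x => by
        rw [Real.norm_eq_abs, abs_of_pos (Real.exp_pos _)]
        exact Real.exp_le_exp.2 ((le_abs_self _).trans (hφb x)))
  set Zψ : ℝ := ∫ x, Real.exp (ψ x) ∂G with hZψ_def
  set Zφ : ℝ := ∫ x, Real.exp (a * ψ x) ∂C with hZφ_def
  have hZψ : 0 < Zψ := integral_exp_pos hexpψ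
  have hZφ : 0 < Zφ := integral_exp_pos hexpφ
  -- Hölder: `Zφ = ∫ e^{aψ} (dC/dG) dG ≤ Zψ ^ a * H ^ (1+γ)⁻¹`
  have hpq : (1 + γ⁻¹ : ℝ).HolderConjugate (1 + γ) :=
    ⟨by rw [inv_one]; field_simp; ring, hp', hp⟩
  have hHolder : Zφ ≤ Zψ ^ (1 / (1 + γ⁻¹)) * H.toReal ^ (1 / (1 + γ)) := by
    have hf : AEMeasurable (fun x => ENNReal.ofReal (Real.exp (a * ψ x))) G :=
      (hψm.const_mul a).exp.ennreal_ofReal.aemeasurable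
    have hg : AEMeasurable (C.rnDeriv G) G := (Measure.measurable_rnDeriv C G).aemeasurable
    have h := ENNReal.lintegral_mul_le_Lp_mul_Lq G hpq hf hg
    have hlhs : ∫⁻ x, ((fun x => ENNReal.ofReal (Real.exp (a * ψ x))) * C.rnDeriv G) x ∂G
        = ENNReal.ofReal Zφ := by
      rw [hZφ_def, ofReal_integral_eq_lintegral_ofReal hexpφ
        (ae_of_all _ fun x => (Real.exp_pos _).le), ← lintegral_rnDeriv_mul hCG hf]
      refine lintegral_congr fun x => ?_
      simp only [Pi.mul_apply, mul_comm]
    have hf' : ∫⁻ x, (ENNReal.ofReal (Real.exp (a * ψ x))) ^ (1 + γ⁻¹ : ℝ) ∂G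
        = ENNReal.ofReal Zψ := by
      rw [hZψ_def, ofReal_integral_eq_lintegral_ofReal hexpψ
        (ae_of_all _ fun x => (Real.exp_pos _).le)]
      refine lintegral_congr fun x => ?_
      rw [ENNReal.ofReal_rpow_of_pos (Real.exp_pos _), ← Real.exp_mul]
      congr 2
      rw [ha_def]
      field_simp
    rw [hlhs, hf', ← hHint] at h
    have hne : ENNReal.ofReal Zψ ^ (1 / (1 + γ⁻¹) : ℝ) * H ^ (1 / (1 + γ) : ℝ) ≠ ∞ :=
      ENNReal.mul_ne_top (ENNReal.rpow_ne_top_of_nonneg (by positivity) ENNReal.ofReal_ne_top)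
        (ENNReal.rpow_ne_top_of_nonneg (by positivity) hHtop)
    rw [ENNReal.ofReal_le_iff_le_toReal hne, ENNReal.toReal_mul, ← ENNReal.toReal_rpow,
      ← ENNReal.toReal_rpow, ENNReal.toReal_ofReal hZψ.le] at h
    exact h
  -- `H > 0` (else Hölder would force `Zφ ≤ 0`)
  have hHpos : 0 < H.toReal := by
    rcases (ENNReal.toReal_nonneg : 0 ≤ H.toReal).lt_or_eq with h | h
    · exact h
    · exfalso
      rw [← h, Real.zero_rpow (by positivity), mul_zero] at hHolder
      exact absurd hHolder (not_le.mpr hZφ)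
  -- take logarithms and assemble
  have hlog : Real.log Zφ ≤ a * Real.log Zψ + (1 + γ)⁻¹ * L := by
    have h := Real.log_le_log hZφ hHolder
    rwa [Real.log_mul (Real.rpow_pos_of_pos hZψ _).ne' (Real.rpow_pos_of_pos hHpos _).ne',
      Real.log_rpow hZψ, Real.log_rpow hHpos, one_div, one_div] at h
  have hkey : a * ∫ x, ψ x ∂A ≤ K₁ + a * Real.log Zψ + (1 + γ)⁻¹ * L := by linarith
  have hab : a * ((1 + γ⁻¹) * K₁ + γ⁻¹ * L + Real.log Zψ)
      = K₁ + a * Real.log Zψ + (1 + γ)⁻¹ * L := by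
    rw [ha_def]
    field_simp
    ring
  rw [← hab] at hkey
  exact le_of_mul_le_mul_left hkey ha0

end Summit.AtomisticToContinuum.HydrodynamicLimit.Theorems.RestartPrinciple.IsentropicRegibbsification

end
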